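import Summits.BirchSwinnertonDyer.BirchSwinnertonDyer.Theorems.QuadraticBranchSignedControlPlusEtaNonsurjThetaFunctionalEquationNormCoordinateCubic
import HarnessLib

/-!
# Route `QuadraticBranchSignedControl` (rung K8, cell `bsd-potss`), residual crux `PlusEtaMainConjectureNonsurj`
# (stmt-BirchSwinnertonDyer-19606): THE FUNCTIONAL EQUATION ON THE QUADRATIC BRANCH, XLII — THE CUBIC VERTEX TEST: **a monic cubic
# `Z³ + h₂Z² + h₁Z + h₀ ∈ ℤ_p[Z]` with `p² ∣ h₀`, `p ∥ h₁`, `p ∣ h₂` has a root in `pℤ_p`** (Hensel at `p·y₀`, `y₀ = −(h₀/p²)(h₁/p)⁻¹`: the length-one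
# slope-`−1` segment of the Newton polygon), hence is NOT irreducible — the reading of the `k = 3` row cm36a2_449 of P-31M part 2
# (`H ≡ Z³ + 15Z² + 65Z + 75 (mod 125)`) (seat `bsd-potss-k8eta-c2` g31; kernel, fact-free)

WHY. Part XLI gave two cubic tests (a root from the lowest vertex when `‖h₀‖ < ‖h₁‖²`; irreducibility when `‖h₀‖ = p⁻²`, `‖h₁‖ ≤ p⁻²`,
`‖h₂‖ ≤ p⁻¹`). The level-6 digits of the last undecided cubic row of the census (kit j339977 / j340047: `(v(h₀), v(h₁), v(h₂)) = (2, 1, 1)`) fall in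
neither: the Newton polygon is `(0,2)–(1,1)–(3,0)`, whose first segment has integer slope `−1` and length `1`. THIS FILE proves the corresponding
root: with `h₀ = p²b`, `h₁ = pa`, `a ∈ ℤ_pˣ`, `p ∣ h₂`, put `y₀ = −b·a⁻¹` (so `ay₀ + b = 0`); then `H(py₀) = p³y₀³ + p²h₂y₀²` has norm `≤ p⁻³` and
`H′(py₀) = p(a + p(3y₀² + 2(h₂/p)y₀))` has norm exactly `p⁻¹`, so Hensel's lemma gives a root `z` with `‖z − py₀‖ < p⁻¹`, i.e. `z ∈ pℤ_p`; by Part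
XLI `H` is not irreducible, and under the Kato reading (Parts XXXIII/XXXIV) `H_alg` ranges over the monic divisors of `(Z − z)·Q`.

WHAT (3 theorems). §123 `norm_le_inv_of_dvd`, **`exists_root_of_cubic_vertex`**, **`not_irreducible_of_cubic_vertex`**.

HONEST FRAMING (cell `bsd-potss`; FULL-BSD rank ≤ 1 programme, HUMAN RULING D-0036/D-0074): TOOL THEOREMS ONLY — `p`-adic algebra; no
definition, no named fact, no `sorry`, axioms standard; the row name is a census label; nothing about (A), (C1⁺_η), C-cc-1 or `BSD(W,p)` is claimed;
crux and route OPEN; nothing booked. `--supports stmt-BirchSwinnertonDyer-19606`.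

References: K. Conrad, Hensel's lemma (Mathlib `hensels_lemma`); Newton polygons (Koblitz IV.3, guide only). Tree: Part XLI (`eval_eq_of_natDegree_three`,
`not_irreducible_of_root`).
-/

set_option autoImplicit false
set_option linter.dupNamespace false
noncomputable section

open scoped Classical Topology

open PowerSeries Literature.NumberTheory.EllipticCurves Literature.NumberTheory.EllipticCurves.IwasawaAlgebra

namespace Summit.BirchSwinnertonDyer.BirchSwinnertonDyer.Theorems.EtaThetaFunctionalEquation

variable {p : ℕ} [hp : Fact p.Prime]

/-! ## §123 The cubic vertex test -/

/-- `p ∣ x ⟹ ‖x‖ ≤ p⁻¹` in `ℤ_p`. [folklore] -/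
theorem norm_le_inv_of_dvd {x : ℤ_[p]} (h : (p : ℤ_[p]) ∣ x) : ‖x‖ ≤ (p : ℝ)⁻¹ := by
  obtain ⟨c, rfl⟩ := h
  rw [norm_mul, PadicInt.norm_p]
  exact mul_le_of_le_one_right (by positivity) (PadicInt.norm_le_one c)

/-- **THE CUBIC VERTEX TEST ⟹ A ROOT IN `pℤ_p`.** `H = Z³ + h₂Z² + h₁Z + h₀` monic over `ℤ_p` with `h₀ = p²·b`, `h₁ = p·a`, `a ∈ ℤ_pˣ` (`p ∤ a`)
and `p ∣ h₂`: there is `z ∈ ℤ_p` with `H(z) = 0` and `p ∣ z` (Hensel's lemma at `p·y₀`, `y₀ = −b·a⁻¹`: `‖H(py₀)‖ ≤ p⁻³ < p⁻² = ‖H′(py₀)‖²`).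
[folklore] -/
theorem exists_root_of_cubic_vertex {H : Polynomial ℤ_[p]} (hmon : H.Monic) (h3 : H.natDegree = 3) {a b : ℤ_[p]}
    (h0 : H.coeff 0 = (p : ℤ_[p]) ^ 2 * b) (h1 : H.coeff 1 = p * a) (ha : ¬ (p : ℤ_[p]) ∣ a) (h2 : (p : ℤ_[p]) ∣ H.coeff 2) :
    ∃ z : ℤ_[p], H.eval z = 0 ∧ (p : ℤ_[p]) ∣ z := by
  have hp1 : (1 : ℝ) < p := Nat.one_lt_cast.mpr hp.out.one_lt
  have hq0 : (0 : ℝ) < (p : ℝ)⁻¹ := by positivity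
  have hq1 : (p : ℝ)⁻¹ < 1 := inv_lt_one_of_one_lt₀ hp1
  -- `a` is a unit: `a·ai = 1`
  have hau : IsUnit a := PadicInt.isUnit_iff.mpr (norm_eq_one_of_not_dvd ha)
  obtain ⟨ai, hai⟩ := hau.exists_right_inv
  obtain ⟨c, hc⟩ := h2
  set y₀ : ℤ_[p] := -b * ai with hy₀
  have hlin : a * y₀ + b = 0 := by rw [hy₀]; linear_combination (-b) * hai
  have hev : ∀ x : ℤ_[p], H.eval x = x ^ 3 + H.coeff 2 * x ^ 2 + H.coeff 1 * x + H.coeff 0 := eval_eq_of_natDegree_three hmon h3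
  have hH : H = Polynomial.X ^ 3 + Polynomial.C (H.coeff 2) * Polynomial.X ^ 2 + Polynomial.C (H.coeff 1) * Polynomial.X + Polynomial.C (H.coeff 0) := by
    have htop : H.coeff 3 = 1 := by rw [← h3]; exact hmon.coeff_natDegree
    ext n
    simp only [Polynomial.coeff_add, Polynomial.coeff_X_pow, Polynomial.coeff_C_mul, Polynomial.coeff_X, Polynomial.coeff_C]
    by_cases hn0 : n = 0
    · subst hn0; simp
    by_cases hn1 : n = 1
    · subst hn1; simp
    by_cases hn2 : n = 2
    · subst hn2; simp
    by_cases hn3 : n = 3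
    · subst hn3; simp [htop]
    have hcn : H.coeff n = 0 := Polynomial.coeff_eq_zero_of_natDegree_lt (by omega)
    simp [hcn, hn0, hn2, hn3, Ne.symm hn1]
  have hder : ∀ x : ℤ_[p], H.derivative.eval x = 3 * x ^ 2 + 2 * H.coeff 2 * x + H.coeff 1 := fun x ↦ by
    conv_lhs => rw [hH]
    simp only [Polynomial.derivative_add, Polynomial.derivative_X_pow, Polynomial.derivative_mul, Polynomial.derivative_C,
      Polynomial.derivative_X, zero_mul, mul_one, zero_add, add_zero, Polynomial.eval_add, Polynomial.eval_mul,
      Polynomial.eval_C, Polynomial.eval_X, Polynomial.eval_pow, Nat.cast_ofNat, map_ofNat, Polynomial.eval_ofNat]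
    ring
  -- the Hensel datum at `p·y₀`
  have e1 : H.eval ((p : ℤ_[p]) * y₀) = (p : ℤ_[p]) ^ 3 * (y₀ ^ 3 + c * y₀ ^ 2) := by
    rw [hev, h0, h1, hc]; linear_combination (p : ℤ_[p]) ^ 2 * hlin
  have e2 : H.derivative.eval ((p : ℤ_[p]) * y₀) = (p : ℤ_[p]) * (a + p * (3 * y₀ ^ 2 + 2 * c * y₀)) := by
    rw [hder, h1, hc]; ring
  have hn1 : ‖H.derivative.eval ((p : ℤ_[p]) * y₀)‖ = (p : ℝ)⁻¹ := by
    rw [e2, norm_mul, PadicInt.norm_p]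
    have hu : ‖a + p * (3 * y₀ ^ 2 + 2 * c * y₀)‖ = 1 := by
      refine norm_eq_one_of_not_dvd fun ⟨d, hd⟩ ↦ ha ⟨d - (3 * y₀ ^ 2 + 2 * c * y₀), by linear_combination hd⟩
    rw [hu, mul_one]
  have hn0 : ‖H.eval ((p : ℤ_[p]) * y₀)‖ ≤ ((p : ℝ)⁻¹) ^ 3 := by
    rw [e1, norm_mul, norm_pow, PadicInt.norm_p]
    exact mul_le_of_le_one_right (by positivity) (PadicInt.norm_le_one _)
  have hn : ‖Polynomial.aeval ((p : ℤ_[p]) * y₀) H‖ < ‖Polynomial.aeval ((p : ℤ_[p]) * y₀) (Polynomial.derivative H)‖ ^ 2 := by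
    rw [Polynomial.coe_aeval_eq_eval, hn1]
    refine hn0.trans_lt ?_
    have : ((p : ℝ)⁻¹) ^ 3 = ((p : ℝ)⁻¹) ^ 2 * (p : ℝ)⁻¹ := by ring
    rw [this]
    exact mul_lt_of_lt_one_right (pow_pos hq0 2) hq1
  obtain ⟨z, hz, hza, -, -⟩ := hensels_lemma hn
  rw [Polynomial.coe_aeval_eq_eval] at hz hza
  rw [hn1] at hza
  refine ⟨z, hz, ?_⟩
  -- `‖z − p y₀‖ < p⁻¹ ⟹ p ∣ z − p y₀ ⟹ p ∣ z`
  have hdvd : (p : ℤ_[p]) ∣ z - p * y₀ := (PadicInt.norm_lt_one_iff_dvd _).mp (hza.trans hq1)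
  obtain ⟨d, hd⟩ := hdvd
  exact ⟨d + y₀, by linear_combination hd⟩

/-- **THE CUBIC VERTEX TEST ⟹ NOT IRREDUCIBLE**: under the hypotheses of `exists_root_of_cubic_vertex` the cubic `H` has a root, hence is a
product `(Z − z)·Q` and is not irreducible; under the Kato reading (Part XXXIII) the algebraic norm polynomial ranges over the monic divisors of
`(Z − z)·Q`. P-31M part 2: cm36a2_449, `H ≡ Z³ + 15Z² + 65Z + 75 (mod 125)` (`b ≡ 3`, `a ≡ 13`, `h₂ ≡ 15`). [folklore] -/
theorem not_irreducible_of_cubic_vertex {H : Polynomial ℤ_[p]} (hmon : H.Monic) (h3 : H.natDegree = 3) {a b : ℤ_[p]}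
    (h0 : H.coeff 0 = (p : ℤ_[p]) ^ 2 * b) (h1 : H.coeff 1 = p * a) (ha : ¬ (p : ℤ_[p]) ∣ a) (h2 : (p : ℤ_[p]) ∣ H.coeff 2) :
    ¬ Irreducible H := by
  obtain ⟨z, hz, -⟩ := exists_root_of_cubic_vertex hmon h3 h0 h1 ha h2
  exact not_irreducible_of_root hmon (by omega) hz

end Summit.BirchSwinnertonDyer.BirchSwinnertonDyer.Theorems.EtaThetaFunctionalEquation

end
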